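import Mathlib
import Literature.Analysis.ODE.CodeListMeanValueExtension
import Summits.Ventures.FusionMHD.Models.CerfonFreidbergIterLikeMidplane
import HarnessLib

/-!
# Ventures/FusionMHD — Models/CerfonFreidbergIterLikeCriticalPoint.lean: THE magnetic axis is the ONLY critical point of the
# Cerfon–Freidberg ITER-like flux of record in the whole bounding box of the model plasma, and its strict global minimiser there
# (kernel; two interval range certificates, no new Krawczyk)

HONEST FRAMING (LADDER-GRIDFUSION three columns; CF rung, qualitative companion of S2 #34 «F1.CF-AXIS-ITER» and of the rider «#34″ CF-MIDPLANE»).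
`Models/CerfonFreidbergIterLikeMidplane.lean` (p515982 + §4) settled the MIDPLANE chord: `(X_a, 0)` is the unique critical point of `U` on
`[17/25, 33/25] × {0}` and the strict minimiser of `U(·, 0)`.  THIS FILE leaves the midplane.  Write the `α = 0` family vertically as the even
sextic `U(X, Y) = G₀(X) + G₂(X) Y² + G₄(X) Y⁴ + G₆ Y⁶` (tree `cfSolution_zero_vertical`, Freidberg (6.153)), so that
`U_Y(X, Y) = 2Y · H(X, Y²)` with the **vertical slope factor** `H(X, W) := G₂(X) + 2 G₄(X) W + 3 G₆ W²`.  TWO natural-interval-extension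
range certificates (`evalBoxLE`, soundness `eval_mem_of_evalBoxLE`, Moore 1966 Thm 3.1) of the code list of `H(X, W; c)` over
«(#34's kernel coefficient box) × (X ∈ [17/25, 1] resp. [1, 33/25]) × (W ∈ [0, 9/25])» give **`H ≥ 1/50` on the whole bounding box
`17/25 ≤ X ≤ 33/25`, `|Y| ≤ 3/5`** (the box contains the model plasma: `1 ± ε = 17/25, 33/25`, `κε = (17/10)·(8/25) = 68/125 = 0.544 < 3/5`).  Consequences, all for
THE flux of record `U` (`CFIterLike.U`, #34):
* `dZ_U_eq`, `dZ_U_pos`, `dZ_U_neg`, `dZ_U_eq_zero_iff` — in the box `U_Y` has exactly the sign of `Y`; it vanishes only on the midplane;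
* `isCriticalPoint_iff_axis`, `criticalSet_box_eq` — **the set of critical points of `U` in the box is `{(X_a, 0)}`**: the magnetic axis of #34 is
  the ONLY stationary point of the model flux in `[17/25, 33/25] × [−3/5, 3/5]` (no second O-point, no X-point inside the bounding box);
* `strictMonoOn_U_vertical`, `strictAntiOn_U_vertical`, `U_midplane_lt_of_ne` — every vertical line of the box is a strict valley with floor on
  the midplane; with the midplane profile (`U_axis_lt_of_ne`) **`U(X_a, 0) < U(X, Y)` for every other point of the box** (`U_axis_lt`): the axis
  is the strict global minimiser of the flux of record on the bounding box.
CERTIFIED (kernel): as stated, for the model flux on that box.  MODELLED: analytic CF family (ideal MHD, Solov'ev profiles, fixed analytic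
boundary); nothing here is a stability statement, and nothing is said outside the box (the analytic expression, continued beyond the plasma, has other stationary points —
floating-point Newton finds one near (0.47, 1.05) — NOT certified and irrelevant to the model plasma).  Typer/prover: gridfusion-model-5 (g5), 2026-08-27.
Citations: Freidberg 2014 §6.6.1 (6.151)–(6.155) [Freidberg2014]; Moore 1966 Thm 3.1 / Moore 1979 §4.3 [Moore1979].
-/

noncomputable section

open Set NonemptyInterval Matrix
open Literature.Analysis.ODE Literature.Analysis.ODE.FExpr
open Literature.Analysis.ValidatedNumerics Literature.Analysis.ValidatedNumerics.ITaylor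
open Literature.MathematicalPhysics.MHD Literature.MathematicalPhysics.MHD.GradShafranov
  Literature.MathematicalPhysics.MHD.CerfonFreidberg _root_.Real

namespace Summit.Ventures.FusionMHD.Models.CFIterLike

/-! ## §1 The code list of the vertical slope factor `H(X, W; c)` and the two range certificates -/

/-- Code list of `H(X, W; c) = G₂(X) + 2 G₄(X) W + 3 G₆ W²` (`vertG₂/vertG₄/vertG₆` of the tree): unknowns `x₀…x₆ = c₀…c₆`, `x₇ = X`,
`x₈ = W (= Y²)`; one logarithm, Horner in `X²`.  MODELLED: analytic CF family. -/
def hExpr : FExpr 9 :=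
  add (add (add
      (add (var 2) (mul (pow (var 7) 2) (add (add (smul (-4) (var 3)) (smul (-9) (var 4)))
        (mul (pow (var 7) 2) (add (smul (-12) (var 5)) (smul 75 (var 6)))))))
      (mul (var 8) (add (smul 4 (var 4)) (mul (pow (var 7) 2) (add (smul 16 (var 5)) (smul (-280) (var 6)))))))
      (mul (pow (var 8) 2) (smul 24 (var 6))))
    (mul (log (var 7)) (mul (pow (var 7) 2)
      (add (add (smul (-12) (var 4)) (mul (pow (var 7) 2) (smul 180 (var 6)))) (mul (var 8) (smul (-240) (var 6))))))

/-- The two `X`-pieces covering `[17/25, 33/25]`. -/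
def xPiece : Fin 2 → Iv :=
  ![⟨((17 / 25), 1), by decide +kernel⟩, ⟨(1, (33 / 25)), by decide +kernel⟩]

/-- The `W = Y²` range `[0, 9/25]` (i.e. `|Y| ≤ 3/5`). -/
def wRange : Iv := ⟨(0, (9 / 25)), by decide +kernel⟩

/-- The box «coefficient box of #34 (coordinates 0–6 of `axKrawczyk.box`) × X-piece `j` × W-range». -/
def hBox (j : Fin 2) : Fin 9 → Iv :=
  fun i => if h : (i : ℕ) < 7 then axKrawczyk.box ⟨i, by omega⟩ else if (i : ℕ) = 7 then xPiece j else wRange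

/-- Endpoints of the pieces (decided). -/
theorem xPiece_eq : ((xPiece 0).fst = 17 / 25 ∧ (xPiece 0).snd = 1) ∧ ((xPiece 1).fst = 1 ∧ (xPiece 1).snd = 33 / 25) := by
  decide +kernel

/-- Endpoints of the `W`-range (decided). -/
theorem wRange_eq : wRange.fst = 0 ∧ wRange.snd = 9 / 25 := by
  decide +kernel

/-- **THE TWO RANGE CERTIFICATES:** on both pieces the natural interval extension of `H` lies in `[1/50, 1/2]` (seeds ⟨64, 60, 56, 4, 0⟩). -/
theorem h_range_cert : ∀ j : Fin 2, evalBoxLE ⟨64, 60, 56, 4, 0⟩ hExpr (hBox j) ⟨((1 / 50), (1 / 2)), by decide +kernel⟩ = true := by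
  decide +kernel

/-! ## §2 Bridge and membership -/

/-- The coefficient vector carried by a point of the 9-space. -/
def hCoeffs (y : Fin 9 → ℝ) : Fin 7 → ℝ := ![y 0, y 1, y 2, y 3, y 4, y 5, y 6]

/-- `⟦hExpr⟧(y) = H(y₇, y₈; hCoeffs y)`. -/
theorem eval_hExpr (y : Fin 9 → ℝ) :
    hExpr.eval y = vertG₂ (hCoeffs y) (y 7) + 2 * vertG₄ (hCoeffs y) (y 7) * y 8 + 3 * vertG₆ (hCoeffs y) (y 7) * y 8 ^ 2 := by
  simp [hExpr, FExpr.eval, hCoeffs, vertG₂, vertG₄, vertG₆]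
  ring

/-- The point `(coeff, X, W)` of the 9-space. -/
def hPoint (X W : ℝ) : Fin 9 → ℝ :=
  fun i => if h : (i : ℕ) < 7 then axZero ⟨i, by omega⟩ else if (i : ℕ) = 7 then X else W

/-- Its coefficient part is `coeff`. -/
theorem hCoeffs_hPoint (X W : ℝ) : hCoeffs (hPoint X W) = coeff := by
  funext k
  fin_cases k <;> simp [hCoeffs, hPoint, coeff, axCoeffs, coeffs, axProj]

/-- Coordinate 7 is `X`. -/
theorem hPoint_seven (X W : ℝ) : hPoint X W 7 = X := by
  simp [hPoint]

/-- Coordinate 8 is `W`. -/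
theorem hPoint_eight (X W : ℝ) : hPoint X W 8 = W := by
  simp [hPoint]

/-- For `X` in piece `j` and `W` in the range, `(coeff, X, W)` lies in `hBox j`. -/
theorem hPoint_mem {j : Fin 2} {X W : ℝ} (hlo : ((xPiece j).fst : ℝ) ≤ X) (hhi : X ≤ ((xPiece j).snd : ℝ))
    (hW0 : ((wRange.fst : ℚ) : ℝ) ≤ W) (hW1 : W ≤ ((wRange.snd : ℚ) : ℝ)) :
    hPoint X W ∈ boxSet (castBox (hBox j)) := by
  have hz := mem_boxSet_iff.mp axZero_mem
  rw [mem_boxSet_iff]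
  intro i
  rw [castBox_apply, mem_ratCast_iff]
  by_cases hi : (i : ℕ) < 7
  · have h := hz ⟨i, by omega⟩
    rw [castBox_apply, mem_ratCast_iff] at h
    simp only [hBox, hPoint, hi, dif_pos]
    exact h
  · by_cases h7 : (i : ℕ) = 7
    · simp only [hBox, hPoint, h7, if_true]
      exact ⟨hlo, hhi⟩
    · simp only [hBox, hPoint, hi, h7, dif_neg, not_false_eq_true, if_false]
      exact ⟨hW0, hW1⟩

/-! ## §3 The vertical slope factor is positive on the box; `U_Y` has the sign of `Y` -/

/-- **`H(X, Y²) ≥ 1/50 > 0` on the bounding box** `17/25 ≤ X ≤ 33/25`, `Y² ≤ 9/25`. -/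
theorem vertSlope_lb {X Y : ℝ} (h1 : (17 : ℝ) / 25 ≤ X) (h2 : X ≤ 33 / 25) (hY : Y ^ 2 ≤ 9 / 25) :
    1 / 50 ≤ vertG₂ coeff X + 2 * vertG₄ coeff X * Y ^ 2 + 3 * vertG₆ coeff X * Y ^ 4 := by
  have key : ∀ j : Fin 2, ((xPiece j).fst : ℝ) ≤ X → X ≤ ((xPiece j).snd : ℝ) →
      1 / 50 ≤ vertG₂ coeff X + 2 * vertG₄ coeff X * Y ^ 2 + 3 * vertG₆ coeff X * Y ^ 4 := by
    intro j hlo hhi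
    have hW0 : ((wRange.fst : ℚ) : ℝ) ≤ Y ^ 2 := by rw [wRange_eq.1]; push_cast; positivity
    have hW1 : Y ^ 2 ≤ ((wRange.snd : ℚ) : ℝ) := by rw [wRange_eq.2]; push_cast; linarith
    have hmem := hPoint_mem hlo hhi hW0 hW1
    have h := eval_mem_of_evalBoxLE (h_range_cert j) hmem
    rw [mem_ratCast_iff] at h
    have hev : hExpr.eval (hPoint X (Y ^ 2))
        = vertG₂ coeff X + 2 * vertG₄ coeff X * Y ^ 2 + 3 * vertG₆ coeff X * Y ^ 4 := by
      rw [eval_hExpr, hCoeffs_hPoint, hPoint_seven, hPoint_eight]; ring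
    rw [hev] at h
    have : (((1 : ℚ) / 50 : ℚ) : ℝ) = 1 / 50 := by push_cast; ring
    linarith [h.1]
  obtain ⟨⟨a1, a2⟩, ⟨b1, b2⟩⟩ := xPiece_eq
  by_cases ha : X ≤ 1
  · exact key 0 (by rw [a1]; push_cast; linarith) (by rw [a2]; push_cast; linarith)
  · exact key 1 (by rw [b1]; push_cast; linarith) (by rw [b2]; push_cast; linarith)

/-- `|Y| ≤ 3/5` gives `Y² ≤ 9/25`. -/
theorem sq_le_of_mem_Icc {Y : ℝ} (hY : Y ∈ Icc (-(3 : ℝ) / 5) (3 / 5)) : Y ^ 2 ≤ 9 / 25 := by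
  obtain ⟨h1, h2⟩ := hY
  nlinarith

/-- **`U_Y = 2Y · H(X, Y²)`** for the flux of record (tree `dZ_cfSolution_zero`). -/
theorem dZ_U_eq (X Y : ℝ) :
    dZ U X Y = 2 * Y * (vertG₂ coeff X + 2 * vertG₄ coeff X * Y ^ 2 + 3 * vertG₆ coeff X * Y ^ 4) := by
  have h : dZ (cfSolution 0 coeff) X Y = 2 * vertG₂ coeff X * Y + 4 * vertG₄ coeff X * Y ^ 3 + 6 * vertG₆ coeff X * Y ^ 5 :=
    dZ_cfSolution_zero coeff X Y
  rw [show U = cfSolution 0 coeff from rfl, h]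
  ring

/-- In the box, `U_Y > 0` above the midplane. -/
theorem dZ_U_pos {X Y : ℝ} (hX : X ∈ Icc (17 / 25 : ℝ) (33 / 25)) (hY : Y ∈ Icc (-(3 : ℝ) / 5) (3 / 5)) (hpos : 0 < Y) :
    0 < dZ U X Y := by
  have hH := vertSlope_lb hX.1 hX.2 (sq_le_of_mem_Icc hY)
  rw [dZ_U_eq]
  have : 0 < vertG₂ coeff X + 2 * vertG₄ coeff X * Y ^ 2 + 3 * vertG₆ coeff X * Y ^ 4 := by linarith
  positivity

/-- In the box, `U_Y < 0` below the midplane. -/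
theorem dZ_U_neg {X Y : ℝ} (hX : X ∈ Icc (17 / 25 : ℝ) (33 / 25)) (hY : Y ∈ Icc (-(3 : ℝ) / 5) (3 / 5)) (hneg : Y < 0) :
    dZ U X Y < 0 := by
  have hH := vertSlope_lb hX.1 hX.2 (sq_le_of_mem_Icc hY)
  rw [dZ_U_eq]
  have hp : 0 < vertG₂ coeff X + 2 * vertG₄ coeff X * Y ^ 2 + 3 * vertG₆ coeff X * Y ^ 4 := by linarith
  nlinarith

/-- **In the box `U_Y = 0` iff `Y = 0`** (the vertical derivative vanishes only on the midplane). -/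
theorem dZ_U_eq_zero_iff {X Y : ℝ} (hX : X ∈ Icc (17 / 25 : ℝ) (33 / 25)) (hY : Y ∈ Icc (-(3 : ℝ) / 5) (3 / 5)) :
    dZ U X Y = 0 ↔ Y = 0 := by
  constructor
  · intro h0
    by_contra hne
    rcases lt_or_gt_of_ne hne with hlt | hgt
    · exact absurd h0 (ne_of_lt (dZ_U_neg hX hY hlt))
    · exact absurd h0 (ne_of_gt (dZ_U_pos hX hY hgt))
  · intro h; rw [h]; exact dZ_cfSolution_zero_midplane coeff X

/-! ## §4 THE magnetic axis is the only critical point in the box -/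

/-- **A point of the box is a critical point of the flux of record iff it is the magnetic axis `(X_a, 0)`.** -/
theorem isCriticalPoint_iff_axis {X Y : ℝ} (hX : X ∈ Icc (17 / 25 : ℝ) (33 / 25)) (hY : Y ∈ Icc (-(3 : ℝ) / 5) (3 / 5)) :
    IsCriticalPoint U X Y ↔ X = Xa ∧ Y = 0 := by
  constructor
  · intro h
    have hY0 : Y = 0 := (dZ_U_eq_zero_iff hX hY).mp h.2
    subst hY0
    exact ⟨(midplane_isCriticalPoint_iff hX).mp h, rfl⟩
  · rintro ⟨rfl, rfl⟩
    exact axis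

/-- **The critical set of `U` in the bounding box `[17/25, 33/25] × [−3/5, 3/5]` is `{(X_a, 0)}`.** -/
theorem criticalSet_box_eq :
    {p : ℝ × ℝ | p.1 ∈ Icc (17 / 25 : ℝ) (33 / 25) ∧ p.2 ∈ Icc (-(3 : ℝ) / 5) (3 / 5) ∧ IsCriticalPoint U p.1 p.2} = {(Xa, 0)} := by
  ext p
  simp only [mem_setOf_eq, mem_singleton_iff]
  constructor
  · rintro ⟨hX, hY, hc⟩
    obtain ⟨h1, h2⟩ := (isCriticalPoint_iff_axis hX hY).mp hc
    exact Prod.ext h1 h2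
  · intro hp
    subst hp
    refine ⟨Xa_mem_chord, ⟨by norm_num, by norm_num⟩, axis⟩

/-! ## §5 Vertical valleys and the global minimum at the axis -/

/-- The vertical section `Y ↦ U(X, Y)` is the even sextic of the tree (so it is continuous). -/
theorem U_vertical_eq (X : ℝ) :
    U X = fun Y => vertG₀ coeff X + vertG₂ coeff X * Y ^ 2 + vertG₄ coeff X * Y ^ 4 + vertG₆ coeff X * Y ^ 6 := by
  have h := cfSolution_zero_vertical coeff X
  rw [show U = cfSolution 0 coeff from rfl]
  exact h

/-- Continuity of every vertical section. -/
theorem continuous_U_vertical (X : ℝ) : Continuous (U X) := by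
  rw [U_vertical_eq]; fun_prop

/-- **Strict increase above the midplane:** for `X` in the chord range, `Y ↦ U(X, Y)` is strictly increasing on `[0, 3/5]`. -/
theorem strictMonoOn_U_vertical {X : ℝ} (hX : X ∈ Icc (17 / 25 : ℝ) (33 / 25)) : StrictMonoOn (U X) (Icc 0 (3 / 5 : ℝ)) := by
  apply strictMonoOn_of_deriv_pos (convex_Icc _ _) (continuous_U_vertical X).continuousOn
  intro y hy
  rw [interior_Icc] at hy
  have h : 0 < dZ U X y := dZ_U_pos hX ⟨by linarith [hy.1], hy.2.le⟩ hy.1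
  exact h

/-- **Strict decrease below the midplane:** `Y ↦ U(X, Y)` is strictly decreasing on `[−3/5, 0]`. -/
theorem strictAntiOn_U_vertical {X : ℝ} (hX : X ∈ Icc (17 / 25 : ℝ) (33 / 25)) : StrictAntiOn (U X) (Icc (-(3 : ℝ) / 5) 0) := by
  apply strictAntiOn_of_deriv_neg (convex_Icc _ _) (continuous_U_vertical X).continuousOn
  intro y hy
  rw [interior_Icc] at hy
  have h : dZ U X y < 0 := dZ_U_neg hX ⟨hy.1.le, by linarith [hy.2]⟩ hy.2
  exact h

/-- **The midplane is the valley floor:** `U(X, 0) < U(X, Y)` for `0 < |Y| ≤ 3/5`. -/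
theorem U_midplane_lt_of_ne {X Y : ℝ} (hX : X ∈ Icc (17 / 25 : ℝ) (33 / 25)) (hY : Y ∈ Icc (-(3 : ℝ) / 5) (3 / 5)) (hne : Y ≠ 0) :
    U X 0 < U X Y := by
  rcases lt_or_gt_of_ne hne with hlt | hgt
  · exact strictAntiOn_U_vertical hX ⟨hY.1, hlt.le⟩ ⟨by norm_num, le_rfl⟩ hlt
  · exact strictMonoOn_U_vertical hX ⟨le_rfl, by norm_num⟩ ⟨hgt.le, hY.2⟩ hgt

/-- **THE axis is the strict global minimiser of the flux of record on the bounding box:** `U(X_a, 0) < U(X, Y)` for every other point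
`(X, Y)` of `[17/25, 33/25] × [−3/5, 3/5]`. -/
theorem U_axis_lt {X Y : ℝ} (hX : X ∈ Icc (17 / 25 : ℝ) (33 / 25)) (hY : Y ∈ Icc (-(3 : ℝ) / 5) (3 / 5)) (hne : (X, Y) ≠ (Xa, 0)) :
    U Xa 0 < U X Y := by
  by_cases hY0 : Y = 0
  · subst hY0
    have hXne : X ≠ Xa := fun h => hne (by rw [h])
    exact U_axis_lt_of_ne hX hXne
  · have h1 : U X 0 < U X Y := U_midplane_lt_of_ne hX hY hY0
    by_cases hXa : X = Xa
    · rw [hXa] at h1 ⊢; exact h1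
    · exact lt_trans (U_axis_lt_of_ne hX hXa) h1

/-- The minimum value and the argmin as one statement: on the box `U ≥ U(X_a, 0)`, with equality iff `(X, Y) = (X_a, 0)`. -/
theorem U_axis_le_iff {X Y : ℝ} (hX : X ∈ Icc (17 / 25 : ℝ) (33 / 25)) (hY : Y ∈ Icc (-(3 : ℝ) / 5) (3 / 5)) :
    U Xa 0 ≤ U X Y ∧ (U X Y = U Xa 0 ↔ (X, Y) = (Xa, 0)) := by
  by_cases h : (X, Y) = (Xa, 0)
  · have hX' : X = Xa := congrArg Prod.fst h
    have hY' : Y = 0 := congrArg Prod.snd h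
    subst hX' hY'
    exact ⟨le_rfl, by simp⟩
  · have hlt := U_axis_lt hX hY h
    exact ⟨hlt.le, ⟨fun he => absurd he (ne_of_gt hlt), fun he => absurd he h⟩⟩

end Summit.Ventures.FusionMHD.Models.CFIterLike
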